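import Literature.AnabelianGeometry.SemiGraphs.BTempQDPairCoversDirected
import Literature.AnabelianGeometry.SemiGraphs.BTempQDPairRealisation
import Literature.AnabelianGeometry.SemiGraphs.QDPairHomHatTransport
import HarnessLib

/-!
# Semi-graphs of anabelioids, Appendix, proof of Theorem A.4: the category `P_i` and the
# equivalence `P_i ⥲ T_i` — the STRONGLY CONNECTED CORE, for the model temperoid `B^temp(Π)`

Mochizuki, *Semi-graphs of anabelioids*, Publ. RIMS **42** (2006) 221–322, Appendix, proof of
Theorem A.4, manuscript p. 85 ll. 1–12 (PRIMS p. 314 l. 5 – p. 315 l. 12)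
[cite: MochizukiSemiAnbd2006, Thm A.4 proof pp.84-85]: "Moreover, one verifies immediately that
this reconstruction is compatible with composition of arrows [i.e., composition of arrows in `D_i`
induces composition of "`Hom^`-arrows"]. … Thus, in summary, if we write `P_i` for the category
whose objects are the objects of `D_i` and whose morphisms are given by the "`Hom^`'s", then we
obtain natural functors `Q_i → D_i → P_i ⥲ T_i` — i.e., the first functor maps an object `B` of
`Q_i` to the QD-pair `(B, {1})`; the second functor arises from the construction of `P_i`; the third
functor is the equivalence induced by the natural functor `D_i → T_i` considered above."

Row **A4-lim-P-core** of `plan/L3/SUBDAG-SemiAnbd-Cor311.md` (holder abc-iut-w5-d129; this file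
abc-iut-w4-d081): the category `P` and the equivalence `P ⥲ T` RESTRICTED TO THE STRONGLY CONNECTED
CORE — objects = strongly connected QD-pairs of `T = B^temp(Π)` (a superset of print's "objects of
`D_i`" that are strongly connected, `D_i` = QD-pairs of `Q_i = T_i[A_i]`; the `D_i`-scope refinement
is row A4-q′, the weakly connected / arbitrary objects via `Hom^WC` are rows A4-lim-wc / A4-lim-P),
morphisms `Hom^((B, Γ_B), (C, Γ_C))` (`QDPair.HomHat`, `BTempQDPairHomHat.lean`, abc-iut-w5-d129).
The COMPOSITION LAW on `Hom^` enters as a PARAMETER `QDPair.HomHatCompLaw` = (a composition on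
`Hom^` for strongly connected triples) + (its compatibility `homHatToHom_comp` with the comparison
map `Hom^ → Hom_T`, i.e. print's "compatible with composition of arrows"): print's INTRINSIC law
(components of `B′ ×_C C′`) is row A4-lim-comp (abc-iut-w5-d220) and instantiates the parameter
by name.  PROVED here:

* `q([(id, f̄)]) = q(f)` (`homHatToHom_homHatOfHom`) for the `Hom^`-arrow `[(id, f̄)]` of an arrow `f`
  of `D` (`QDPair.homHatOfHom` over the identity cover `OneProperCover.self`,
  `QDPairHomHatTransport.lean`, abc-iut-w4-d089): these are the identities of `P` and the values of
  the functor `D → P`, `f ↦ [(id, f̄)]` (`PCore.ofD`);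
* `HomHatCompLaw.unique` — ANY TWO composition laws compatible with `q` COINCIDE (the comparison map is
  injective, `QDPair.homHatToHom_injective`, `BTempQDPairCoversDirected.lean`), so the category
  `QDPair.PCore κ` below does not depend on the choice of `κ`; `HomHatCompLaw.transported` — for `Π`
  tempered a law EXISTS, obtained by transport along the bijection `Hom^ ≅ Hom_T`
  (`QDPair.homHatToHom_surjective`, `BTempQDPairRealisation.lean`) — recorded for NON-VACUITY only:
  it is NOT print's construction (that is row A4-lim-comp), to which it is nevertheless EQUAL by
  `HomHatCompLaw.unique`;
* `QDPair.PCore κ` — **the category `P` (core)**: unit and associativity laws from injectivity of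
  `Hom^ → Hom_T`; `PCore.toT : PCore κ ⥤ B^temp(Π)`, `(B, Γ_B) ↦ B/Γ_B`, `[(B′, f̄)] ↦
  (q(B′ → B))⁻¹ ≫ q(f)` — FAITHFUL (`homHatToHom_injective`), FULL for `Π` tempered
  (`homHatToHom_surjective`), valued in connected objects
  (`isConnectedObj_orbitQuotient_of_isStronglyConnected`) and ESSENTIALLY SURJECTIVE onto them ("every
  connected object of `T_i` is isomorphic to the image via `q_i` of a strongly connected QD-pair",
  `exists_stronglyConnected_orbitQuotient_iso`, `BTempQDPairQuotientFunctor.lean`), hence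
  **`PCore.equivConnectedPart : PCore κ ≌ (B^temp(Π))⁰`** (full subcategory of connected objects,
  `ConnectedPart`) — "the third functor is the equivalence induced by the natural functor
  `D_i → T_i`", on the strongly connected core; `PCore.ofDCompToTIso : (D → P → T) ≅ (D → T)`.

Elementary; nothing refers to the IUT corpus; no side is taken on any disputed claim.
-/

open CategoryTheory

namespace Literature.AnabelianGeometry.SemiGraphs

open Literature.AlgebraicGeometry.Frobenioids (IsConnectedObj connectedObjects ConnectedPart)
open Literature.AlgebraicGeometry.Frobenioids.QuasiTemperoid.BTempConnected (nonempty_of_isConnectedObj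
  exists_ρ_eq_of_isConnectedObj isConnectedObj_of_transitive)

universe v₁ u₁ u

namespace QDPair

/-! ### Strongly connected QD-pairs as an object property (any category) -/

section General

variable (Q : Type u₁) [Category.{v₁} Q]

/-- "strongly connected" (Def. A.3 (i)) as an `ObjectProperty` of the category `D` of QD-pairs, so
that the strongly connected QD-pairs form the full subcategory `(stronglyConnected Q).FullSubcategory`
of `D`. [cite: MochizukiSemiAnbd2006, Def A.3(i) p.82] -/
abbrev stronglyConnected : ObjectProperty (QDPair Q) := fun P => P.IsStronglyConnected

end General

variable {G : Type u} [Group G] [TopologicalSpace G] [IsTopologicalGroup G]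

/-! ### `q` of `[(id, f̄)]`; `q` of a strongly connected pair is connected -/

/-- `q` of the `Hom^`-arrow `[(id, f̄)]` over the identity cover is `q(f)` (`(q(id))⁻¹ ≫ q(f) = q(f)`).
[cite: MochizukiSemiAnbd2006, Thm A.4 proof pp.84-85] -/
theorem OneProperCover.self_toHom_mk {P C : QDPair (BTemp G)} (hP : P.IsStronglyConnected)
    (f : P ⟶ C) : (OneProperCover.self P hP).toHom (homBarMk f) = orbitQuotientMap f := by
  rw [OneProperCover.toHom_mk]
  rw [IsIso.inv_comp_eq]
  change orbitQuotientMap f = orbitQuotientMap (𝟙 P) ≫ orbitQuotientMap f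
  have hid : orbitQuotientMap (𝟙 P) = 𝟙 P.orbitQuotient := (orbitQuotientFunctor (G := G)).map_id P
  rw [hid, Category.id_comp]

/-- **`Hom^ → Hom_T` sends `[(id, f̄)]` to `q(f)`**: the natural map `Hom_D → Hom^` (`homHatOfHom`,
p. 84) followed by the comparison map is `q` on arrows ("composition of arrows in `D_i` induces
composition of `Hom^`-arrows"). [cite: MochizukiSemiAnbd2006, Thm A.4 proof pp.84-85] -/
theorem homHatToHom_homHatOfHom {P C : QDPair (BTemp G)} (hP : P.IsStronglyConnected) (f : P ⟶ C) :
    homHatToHom P C (homHatOfHom hP f) = orbitQuotientMap f := by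
  rw [homHatOfHom, homHatToHom_mk, OneProperCover.self_toHom_mk]

/-- `q((B, Γ_B)) = B/Γ_B` of a STRONGLY connected QD-pair of `B^temp(Π)` is connected (`B` is one
`Π`-orbit and `B → B/Γ_B` is an equivariant surjection; no temperedness needed) — the functor
`P → T` lands in connected objects. [cite: MochizukiSemiAnbd2006, Thm A.4 proof p.83] -/
theorem isConnectedObj_orbitQuotient_of_isStronglyConnected {P : QDPair (BTemp G)}
    (hP : P.IsStronglyConnected) : IsConnectedObj P.orbitQuotient := by
  obtain ⟨x₀⟩ := nonempty_of_isConnectedObj P.A hP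
  refine isConnectedObj_of_transitive P.orbitQuotient (P.orbitMk x₀) fun q => ?_
  obtain ⟨x, rfl⟩ := P.orbitMk_surjective q
  obtain ⟨a, ha⟩ := exists_ρ_eq_of_isConnectedObj P.A hP x₀ x
  exact ⟨a, by rw [orbitQuotient_ρ_apply, ha]⟩

/-! ### Composition laws on `Hom^` compatible with `q` -/

variable (G) in
/-- **A composition law on `Hom^` compatible with composition of arrows**: a composition
`Hom^((B₁, Γ₁), (B₂, Γ₂)) × Hom^((B₂, Γ₂), (B₃, Γ₃)) → Hom^((B₁, Γ₁), (B₃, Γ₃))` for strongly connected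
QD-pairs of `B^temp(Π)` under which the comparison maps `Hom^ → Hom_T` are multiplicative ("this
reconstruction is compatible with composition of arrows").  PARAMETER of this file: print's law —
via connected components of `B′ ×_C C′` — is row A4-lim-comp of the sub-DAG; by `HomHatCompLaw.unique`
below there is at most one such law. [cite: MochizukiSemiAnbd2006, Thm A.4 proof p.84] -/
structure HomHatCompLaw : Type (u + 1) where
  /-- the composition `(x, y) ↦ x ≫ y` on `Hom^` for strongly connected `(B₁, Γ₁), (B₂, Γ₂), (B₃, Γ₃)` -/
  comp : ∀ {P₁ P₂ P₃ : QDPair (BTemp G)}, P₁.IsStronglyConnected → P₂.IsStronglyConnected →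
    P₃.IsStronglyConnected → HomHat P₁ P₂ → HomHat P₂ P₃ → HomHat P₁ P₃
  /-- compatibility with composition of arrows: `q(x ≫ y) = q(x) ≫ q(y)` -/
  homHatToHom_comp : ∀ {P₁ P₂ P₃ : QDPair (BTemp G)} (h₁ : P₁.IsStronglyConnected)
    (h₂ : P₂.IsStronglyConnected) (h₃ : P₃.IsStronglyConnected) (x : HomHat P₁ P₂) (y : HomHat P₂ P₃),
    homHatToHom P₁ P₃ (comp h₁ h₂ h₃ x y) = homHatToHom P₁ P₂ x ≫ homHatToHom P₂ P₃ y

namespace HomHatCompLaw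

/-- **Any two composition laws compatible with `q` agree** on every pair of composable `Hom^`-arrows
(the comparison map `Hom^ → Hom_T` is injective, `homHatToHom_injective`).
[cite: MochizukiSemiAnbd2006, Thm A.4 proof p.84] -/
theorem comp_eq (κ κ' : HomHatCompLaw G) {P₁ P₂ P₃ : QDPair (BTemp G)}
    (h₁ : P₁.IsStronglyConnected) (h₂ : P₂.IsStronglyConnected) (h₃ : P₃.IsStronglyConnected)
    (x : HomHat P₁ P₂) (y : HomHat P₂ P₃) : κ.comp h₁ h₂ h₃ x y = κ'.comp h₁ h₂ h₃ x y :=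
  homHatToHom_injective P₁ P₃ (by rw [κ.homHatToHom_comp, κ'.homHatToHom_comp])

/-- Hence there is AT MOST ONE composition law on `Hom^` compatible with `q`.
[cite: MochizukiSemiAnbd2006, Thm A.4 proof p.84] -/
protected theorem unique (κ κ' : HomHatCompLaw G) : κ = κ' := by
  obtain ⟨c, hc⟩ := κ
  obtain ⟨c', hc'⟩ := κ'
  have h : @c = @c' := by
    funext P₁ P₂ P₃ h₁ h₂ h₃ x y
    exact homHatToHom_injective P₁ P₃ (by rw [hc, hc'])
  cases h
  rfl

/-- **Non-vacuity: for `Π` tempered a composition law compatible with `q` EXISTS**, namely the one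
transported along the bijections `Hom^((B, Γ_B), (C, Γ_C)) ≅ Hom_T(B/Γ_B, C/Γ_C)`
(`homHatToHom_injective` + `homHatToHom_surjective`).  This is NOT print's construction of the
composition (row A4-lim-comp: components of fibre products) — but by `HomHatCompLaw.unique` it is equal
to it. [cite: MochizukiSemiAnbd2006, Thm A.4 proof p.84] -/
noncomputable def transported (hG : IsTempered G) : HomHatCompLaw G where
  comp := @fun P₁ P₂ P₃ h₁ _ _ x y =>
    (homHatToHom_surjective hG P₃ h₁ (homHatToHom P₁ P₂ x ≫ homHatToHom P₂ P₃ y)).choose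
  homHatToHom_comp := @fun P₁ P₂ P₃ h₁ _ _ x y =>
    (homHatToHom_surjective hG P₃ h₁ (homHatToHom P₁ P₂ x ≫ homHatToHom P₂ P₃ y)).choose_spec

end HomHatCompLaw

/-! ### The category `P` (strongly connected core) -/

/-- **The category `P_i`** — objects: the strongly connected QD-pairs `(B, Γ_B)` of `B^temp(Π)`;
morphisms: `Hom^((B, Γ_B), (C, Γ_C))`; composition: the law `κ` (unique by `HomHatCompLaw.unique`);
identities `[(id, 1̄)]`. [cite: MochizukiSemiAnbd2006, Thm A.4 proof p.85] -/
structure PCore (κ : HomHatCompLaw G) : Type (u + 1) where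
  /-- the underlying QD-pair `(B, Γ_B)` -/
  pair : QDPair (BTemp G)
  /-- it is strongly connected -/
  isStronglyConnected : pair.IsStronglyConnected

namespace PCore

variable {κ : HomHatCompLaw G}

/-- Morphisms of `P`: `Hom^((B, Γ_B), (C, Γ_C))`. [cite: MochizukiSemiAnbd2006, Thm A.4 proof p.85] -/
def Hom (P C : PCore κ) : Type (u + 1) := HomHat P.pair C.pair

/-- The identity of `P` at `(B, Γ_B)`: `[(id, 1̄)]`. [cite: MochizukiSemiAnbd2006, Thm A.4 proof p.85] -/
def idHat (P : PCore κ) : Hom P P := homHatOfHom P.isStronglyConnected (𝟙 P.pair)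

/-- Composition of `P`: the law `κ`. [cite: MochizukiSemiAnbd2006, Thm A.4 proof p.85] -/
def compHat {P₁ P₂ P₃ : PCore κ} (x : Hom P₁ P₂) (y : Hom P₂ P₃) : Hom P₁ P₃ :=
  κ.comp P₁.isStronglyConnected P₂.isStronglyConnected P₃.isStronglyConnected x y

/-- `q` of the identity `[(id, 1̄)]` is the identity of `B/Γ_B`. [cite: MochizukiSemiAnbd2006, Thm A.4 proof p.85] -/
theorem homHatToHom_idHat (P : PCore κ) :
    homHatToHom P.pair P.pair (idHat P) = 𝟙 P.pair.orbitQuotient := by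
  rw [idHat, homHatToHom_homHatOfHom]
  exact (orbitQuotientFunctor (G := G)).map_id P.pair

/-- `q` is multiplicative on `P`. [cite: MochizukiSemiAnbd2006, Thm A.4 proof p.85] -/
theorem homHatToHom_compHat {P₁ P₂ P₃ : PCore κ} (x : Hom P₁ P₂) (y : Hom P₂ P₃) :
    homHatToHom P₁.pair P₃.pair (compHat x y) =
      homHatToHom P₁.pair P₂.pair x ≫ homHatToHom P₂.pair P₃.pair y :=
  κ.homHatToHom_comp _ _ _ x y

/-- **`P` is a category** (unit and associativity laws transported back from `T` along the injective
comparison maps `Hom^ → Hom_T`). [cite: MochizukiSemiAnbd2006, Thm A.4 proof p.85] -/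
instance category (κ : HomHatCompLaw G) : Category.{u + 1} (PCore κ) where
  Hom := Hom
  id := idHat
  comp := compHat
  id_comp f := homHatToHom_injective _ _ (by
    rw [homHatToHom_compHat, homHatToHom_idHat, Category.id_comp])
  comp_id f := homHatToHom_injective _ _ (by
    rw [homHatToHom_compHat, homHatToHom_idHat, Category.comp_id])
  assoc f g h := homHatToHom_injective _ _ (by
    rw [homHatToHom_compHat, homHatToHom_compHat, homHatToHom_compHat, homHatToHom_compHat,
      Category.assoc])

/-! ### The functor `P → T` and the equivalence `P ⥲ T⁰` -/

variable (κ)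

/-- **The functor `P → T = B^temp(Π)`** induced by `q`: `(B, Γ_B) ↦ B/Γ_B`,
`[(B′, f̄)] ↦ (q(B′ → B))⁻¹ ≫ q(f)`. [cite: MochizukiSemiAnbd2006, Thm A.4 proof p.85] -/
noncomputable def toT : PCore κ ⥤ BTemp G where
  obj P := P.pair.orbitQuotient
  map f := homHatToHom _ _ f
  map_id P := homHatToHom_idHat P
  map_comp f g := homHatToHom_compHat f g

/-- `P → T` on morphisms is the comparison map `Hom^ → Hom_T`. [cite: MochizukiSemiAnbd2006, Thm A.4 proof p.85] -/
theorem toT_map {P C : PCore κ} (x : P ⟶ C) : (toT κ).map x = homHatToHom P.pair C.pair x := rfl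

/-- **`P → T` is faithful** (`Hom^ → Hom_T` injective, for every pair).
[cite: MochizukiSemiAnbd2006, Thm A.4 proof p.85] -/
instance faithful_toT : (toT κ).Faithful :=
  ⟨fun {P C} => homHatToHom_injective P.pair C.pair⟩

/-- **`P → T` is full** for `Π` tempered (`Hom^ → Hom_T` surjective for a strongly connected source).
[cite: MochizukiSemiAnbd2006, Thm A.4 proof p.85] -/
theorem full_toT (hG : IsTempered G) : (toT κ).Full :=
  ⟨fun {P C} => homHatToHom_surjective hG C.pair P.isStronglyConnected⟩

/-- The functor `P → T⁰` (the full subcategory of connected objects of `T = B^temp(Π)`): `B/Γ_B` is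
connected for `(B, Γ_B)` strongly connected. [cite: MochizukiSemiAnbd2006, Thm A.4 proof p.85] -/
noncomputable def toT₀ : PCore κ ⥤ ConnectedPart (BTemp G) :=
  (connectedObjects (BTemp G)).lift (toT κ) fun P =>
    isConnectedObj_orbitQuotient_of_isStronglyConnected P.isStronglyConnected

/-- `P → T⁰ → T` is `P → T`. [cite: MochizukiSemiAnbd2006, Thm A.4 proof p.85] -/
noncomputable def toT₀CompιIso : toT₀ κ ⋙ (connectedObjects (BTemp G)).ι ≅ toT κ :=
  (connectedObjects (BTemp G)).liftCompιIso (toT κ) _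

/-- **`P → T⁰` is essentially surjective**: "every connected object of `T_i` is isomorphic to the
image via `q_i` of a strongly connected QD-pair" (`exists_stronglyConnected_orbitQuotient_iso`).
[cite: MochizukiSemiAnbd2006, Thm A.4 proof p.83] -/
instance essSurj_toT₀ : (toT₀ κ).EssSurj where
  mem_essImage X := by
    obtain ⟨P, hP, ⟨e⟩⟩ := exists_stronglyConnected_orbitQuotient_iso X.obj X.property
    exact ⟨⟨P, hP⟩, ⟨(connectedObjects (BTemp G)).isoMk e⟩⟩

/-- `P → T⁰` is faithful. [cite: MochizukiSemiAnbd2006, Thm A.4 proof p.85] -/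
instance faithful_toT₀ : (toT₀ κ).Faithful := by
  unfold toT₀; infer_instance

/-- `P → T⁰` is full for `Π` tempered. [cite: MochizukiSemiAnbd2006, Thm A.4 proof p.85] -/
theorem full_toT₀ (hG : IsTempered G) : (toT₀ κ).Full := by
  haveI := full_toT κ hG
  unfold toT₀; infer_instance

/-- **`P → T⁰` is an equivalence of categories** (faithful, full, essentially surjective), `Π`
tempered. [cite: MochizukiSemiAnbd2006, Thm A.4 proof p.85] -/
theorem isEquivalence_toT₀ (hG : IsTempered G) : (toT₀ κ).IsEquivalence :=
  { faithful := faithful_toT₀ κ, full := full_toT₀ κ hG, essSurj := essSurj_toT₀ κ }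

/-- **"the third functor is the equivalence `P_i ⥲ T_i` induced by the natural functor `D_i → T_i`"**
— on the strongly connected core: `P ≌ (B^temp(Π))⁰`, `Π` tempered.
[cite: MochizukiSemiAnbd2006, Thm A.4 proof p.85] -/
noncomputable def equivConnectedPart (hG : IsTempered G) : PCore κ ≌ ConnectedPart (BTemp G) :=
  haveI := isEquivalence_toT₀ κ hG
  (toT₀ κ).asEquivalence

/-- The equivalence is (the lift of) `P → T`. [cite: MochizukiSemiAnbd2006, Thm A.4 proof p.85] -/
theorem equivConnectedPart_functor (hG : IsTempered G) :
    (equivConnectedPart κ hG).functor = toT₀ κ := rfl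

/-- **`P ⥲ T⁰` with no parameter left**: for `Π` tempered, the category `P` built on the (unique,
`HomHatCompLaw.unique`) `q`-compatible composition law — here instantiated by the transported one — is
equivalent to the full subcategory of connected objects of `B^temp(Π)`.
[cite: MochizukiSemiAnbd2006, Thm A.4 proof p.85] -/
noncomputable def equivConnectedPartTransported (hG : IsTempered G) :
    PCore (HomHatCompLaw.transported hG) ≌ ConnectedPart (BTemp G) :=
  equivConnectedPart _ hG

/-! ### The functor `D → P` -/

/-- **"the second functor `D_i → P_i` arises from the construction of `P_i`"**: on the strongly
connected core, `(B, Γ_B) ↦ (B, Γ_B)`, `f ↦ [(id, f̄)]`. [cite: MochizukiSemiAnbd2006, Thm A.4 proof p.85] -/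
noncomputable def ofD : (stronglyConnected (BTemp G)).FullSubcategory ⥤ PCore κ where
  obj P := ⟨P.obj, P.property⟩
  map := @fun P C f => (homHatOfHom (C := C.obj) P.property f.hom : HomHat P.obj C.obj)
  map_id _ := rfl
  map_comp := @fun P₁ P₂ P₃ f g => homHatToHom_injective P₁.obj P₃.obj (by
    change homHatToHom P₁.obj P₃.obj (homHatOfHom (C := P₃.obj) P₁.property (f.hom ≫ g.hom)) =
      homHatToHom P₁.obj P₃.obj (κ.comp P₁.property P₂.property P₃.property
        (homHatOfHom (C := P₂.obj) P₁.property f.hom) (homHatOfHom (C := P₃.obj) P₂.property g.hom))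
    rw [κ.homHatToHom_comp, homHatToHom_homHatOfHom, homHatToHom_homHatOfHom,
      homHatToHom_homHatOfHom]
    exact (orbitQuotientFunctor (G := G)).map_comp f.hom g.hom)

/-- `D → P → T` on morphisms is `q`: `q([(id, f̄)]) = q(f)`. [cite: MochizukiSemiAnbd2006, Thm A.4 proof p.85] -/
theorem toT_map_ofD_map {P C : (stronglyConnected (BTemp G)).FullSubcategory} (f : P ⟶ C) :
    (toT κ).map ((ofD κ).map f) = orbitQuotientMap f.hom :=
  homHatToHom_homHatOfHom P.property f.hom

/-- **`D → P → T` is (isomorphic, with identity components, to) the natural functor `D → T`,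
`(B, Γ_B) ↦ B/Γ_B`** — "the equivalence induced by the natural functor `D_i → T_i`".
[cite: MochizukiSemiAnbd2006, Thm A.4 proof p.85] -/
noncomputable def ofDCompToTIso :
    ofD κ ⋙ toT κ ≅ (stronglyConnected (BTemp G)).ι ⋙ orbitQuotientFunctor :=
  NatIso.ofComponents (fun _ => Iso.refl _) fun f => by
    change (toT κ).map ((ofD κ).map f) ≫ 𝟙 _ = 𝟙 _ ≫ orbitQuotientMap f.hom
    rw [Category.comp_id, Category.id_comp, toT_map_ofD_map]

end PCore

end QDPair

end Literature.AnabelianGeometry.SemiGraphs
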